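import Literature.ModelTheory.ExponentialFields.DefinablyCompleteInverseFunctionTheorem
import HarnessLib

/-!
# The implicit function theorem for systems over a definably complete ordered field

Topic `Literature/ModelTheory/ExponentialFields`.  The classical `C¹` implicit function
theorem for `m` equations in `n + m` unknowns over a definably complete ordered field `K`
(Fornasiero–Servi 2010, §1.2, used in their §8 for the manifold structure of regular zero
sets; van den Dries 1998, Ch. 7, §2), deduced from the inverse function theorem of
`DefinablyCompleteInverseFunctionTheorem.lean` applied to `Φ (x, y) = (x, F (x, y))`.
Points of `Kⁿ⁺ᵐ` are `Fin.append x y`; the unknowns are the last `m` coordinates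
(`Fin.natAdd n j`), the parameters the first `n` (`Fin.castAdd m i`).

* `sum_kronecker_mul` & co., `castAdd_ne_natAdd`, `block_two_sided_inverse` — bookkeeping:
  the block matrix `[[1, 0], [Jx, Jy]]` has the two-sided inverse `[[1, 0], [-Py Jx, Py]]`
  when `Py` is a two-sided inverse of `Jy`;
* `hasPartialDerivAt_apply` — partial derivatives of coordinate functions;
* **`IsDefinablyComplete.exists_implicitFunction_system`** — let `F : Kⁿ⁺ᵐ → Kᵐ` be
  definable and `C¹` on a sup-ball around `append a b` (continuous components, continuous
  partial derivatives `J z k l`), `F (append a b) = 0`, and let the `y`-block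
  `(J (append a b) k (natAdd n j))_{k j}` have a two-sided inverse.  Then there are `r, s > 0`
  and a definable `φ : Kⁿ → Kᵐ` with `φ a = b` such that for `|x - a|_∞ < r`:
  `|φ x - b|_∞ < s`, `F (append x (φ x)) = 0`, `φ x` is the only `y` with `|y - b|_∞ < s` and
  `F (append x y) = 0`, and the components of `φ` are differentiable at `x` with gradients
  `g j` satisfying the implicit-differentiation identities
  `∂F_k/∂xᵢ + Σⱼ ∂F_k/∂yⱼ · g j i = 0` at `append x (φ x)`.

Everything is proved; no definitions, no named facts.  Conventions as in the other
definable-calculus files.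

## References

* A. Fornasiero, T. Servi, *Definably complete Baire structures*, Fund. Math. 209 (2010),
  §1.2, §8. [FornasieroServi2010]
* L. van den Dries, *Tame topology and o-minimal structures* (1998), Ch. 7, §2.
  [Dries1998]
-/

open Set Function FirstOrder FirstOrder.Language
open _root_.Filter _root_.Topology

namespace Literature.ModelTheory.ExponentialFields

universe u v

variable {K : Type*} [Field K] [LinearOrder K] [IsStrictOrderedRing K] [TopologicalSpace K]
  [OrderTopology K] {L : FirstOrder.Language.{u, v}} [L.Structure K] {n m : ℕ}

/-! ### Kronecker sums and index bookkeeping -/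

section Kronecker

omit [LinearOrder K] [IsStrictOrderedRing K] [TopologicalSpace K] [OrderTopology K]
  [L.Structure K]

/-- `Σ_l δ_{l l₀} f l = f l₀`. [folklore] -/
theorem sum_kronecker_mul {ι : Type*} [Fintype ι] [DecidableEq ι] (l₀ : ι) (f : ι → K) :
    ∑ l, (if l = l₀ then (1 : K) else 0) * f l = f l₀ := by
  simp [ite_mul]

/-- `Σ_l δ_{l₀ l} f l = f l₀`. [folklore] -/
theorem sum_kronecker_mul' {ι : Type*} [Fintype ι] [DecidableEq ι] (l₀ : ι) (f : ι → K) :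
    ∑ l, (if l₀ = l then (1 : K) else 0) * f l = f l₀ := by
  simp [ite_mul]

/-- `Σ_l f l δ_{l l₀} = f l₀`. [folklore] -/
theorem sum_mul_kronecker {ι : Type*} [Fintype ι] [DecidableEq ι] (l₀ : ι) (f : ι → K) :
    ∑ l, f l * (if l = l₀ then (1 : K) else 0) = f l₀ := by
  simp [mul_ite]

/-- `Σ_l f l δ_{l₀ l} = f l₀`. [folklore] -/
theorem sum_mul_kronecker' {ι : Type*} [Fintype ι] [DecidableEq ι] (l₀ : ι) (f : ι → K) :
    ∑ l, f l * (if l₀ = l then (1 : K) else 0) = f l₀ := by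
  simp [mul_ite]

end Kronecker

/-- `castAdd m i ≠ natAdd n j` in `Fin (n + m)`. [folklore] -/
theorem castAdd_ne_natAdd (i : Fin n) (j : Fin m) :
    (Fin.castAdd m i : Fin (n + m)) ≠ Fin.natAdd n j := by
  intro h
  have h1 := congrArg Fin.val h
  simp only [Fin.val_castAdd, Fin.val_natAdd] at h1
  omega

omit [LinearOrder K] [IsStrictOrderedRing K] [TopologicalSpace K] [OrderTopology K]
  [L.Structure K] in
/-- **Block-triangular inverse**: if `Py` is a two-sided inverse of `Jy`, then the
`(n + m) × (n + m)` matrices `M = [[1, 0], [Jx, Jy]]` and `P = [[1, 0], [-Py·Jx, Py]]`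
(described through their entries) are two-sided inverses of each other. [folklore] -/
theorem block_two_sided_inverse {Jx : Fin m → Fin n → K} {Jy Py : Fin m → Fin m → K}
    (hPyJy : ∀ k j, ∑ k', Py k k' * Jy k' j = if k = j then 1 else 0)
    (hJyPy : ∀ k j, ∑ k', Jy k k' * Py k' j = if k = j then 1 else 0)
    {M P : Fin (n + m) → Fin (n + m) → K}
    (hM₁ : ∀ i l', M (Fin.castAdd m i) l' = if l' = Fin.castAdd m i then 1 else 0)
    (hM₂ : ∀ k i, M (Fin.natAdd n k) (Fin.castAdd m i) = Jx k i)
    (hM₃ : ∀ k j, M (Fin.natAdd n k) (Fin.natAdd n j) = Jy k j)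
    (hP₁ : ∀ i l', P (Fin.castAdd m i) l' = if l' = Fin.castAdd m i then 1 else 0)
    (hP₂ : ∀ k i, P (Fin.natAdd n k) (Fin.castAdd m i) = -∑ j, Py k j * Jx j i)
    (hP₃ : ∀ k j, P (Fin.natAdd n k) (Fin.natAdd n j) = Py k j) :
    (∀ l₁ l₂, ∑ l, P l₁ l * M l l₂ = if l₁ = l₂ then 1 else 0) ∧
      (∀ l₁ l₂, ∑ l, M l₁ l * P l l₂ = if l₁ = l₂ then 1 else 0) := by
  classical
  constructor
  · intro l₁ l₂
    induction l₁ using Fin.addCases with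
    | left i₁ =>
        simp only [hP₁]
        rw [sum_kronecker_mul, hM₁]
        exact if_congr eq_comm rfl rfl
    | right k₁ =>
        rw [Fin.sum_univ_add]
        simp only [hP₂, hP₃]
        induction l₂ using Fin.addCases with
        | left i₂ =>
            have h1 : ∀ i : Fin n, M (Fin.castAdd m i) (Fin.castAdd m i₂) =
                if i₂ = i then (1 : K) else 0 := fun i => by
              rw [hM₁]; simp
            simp only [h1, hM₂, sum_mul_kronecker', if_neg (castAdd_ne_natAdd i₂ k₁).symm]
            ring
        | right j₂ =>
            have h1 : ∀ i : Fin n, M (Fin.castAdd m i) (Fin.natAdd n j₂) = 0 := fun i => by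
              rw [hM₁, if_neg (castAdd_ne_natAdd i j₂).symm]
            simp only [h1, mul_zero, Finset.sum_const_zero, zero_add, hM₃, hPyJy]
            exact if_congr (Fin.natAdd_inj n).symm rfl rfl
  · intro l₁ l₂
    induction l₁ using Fin.addCases with
    | left i₁ =>
        simp only [hM₁]
        rw [sum_kronecker_mul, hP₁]
        exact if_congr eq_comm rfl rfl
    | right k₁ =>
        rw [Fin.sum_univ_add]
        simp only [hM₂, hM₃]
        induction l₂ using Fin.addCases with
        | left i₂ =>
            have h1 : ∀ i : Fin n, P (Fin.castAdd m i) (Fin.castAdd m i₂) =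
                if i₂ = i then (1 : K) else 0 := fun i => by
              rw [hP₁]; simp
            simp only [h1, hP₂, sum_mul_kronecker', if_neg (castAdd_ne_natAdd i₂ k₁).symm]
            -- `Jx k₁ i₂ + Σ_j Jy k₁ j (-(Σ_j' Py j j' Jx j' i₂)) = 0`
            have h2 : ∑ j, Jy k₁ j * -∑ j', Py j j' * Jx j' i₂ =
                -∑ j', (∑ j, Jy k₁ j * Py j j') * Jx j' i₂ := by
              simp only [mul_neg, Finset.sum_neg_distrib, Finset.mul_sum, Finset.sum_mul]
              rw [Finset.sum_comm]
              refine congrArg Neg.neg (Finset.sum_congr rfl fun j' _ =>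
                Finset.sum_congr rfl fun j _ => by ring)
            rw [h2]
            simp only [hJyPy, sum_kronecker_mul']
            ring
        | right j₂ =>
            have h1 : ∀ i : Fin n, P (Fin.castAdd m i) (Fin.natAdd n j₂) = 0 := fun i => by
              rw [hP₁, if_neg (castAdd_ne_natAdd i j₂).symm]
            simp only [h1, mul_zero, Finset.sum_const_zero, zero_add, hP₃, hJyPy]
            exact if_congr (Fin.natAdd_inj n).symm rfl rfl

/-! ### Partial derivatives of coordinate functions -/

omit [LinearOrder K] [IsStrictOrderedRing K] [OrderTopology K] [L.Structure K] in
/-- The coordinate function `w ↦ w l₀` has partial derivatives `δ_{l l₀}`. [folklore] -/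
theorem hasPartialDerivAt_apply {N : ℕ} (l₀ l : Fin N) (z : Fin N → K) :
    HasPartialDerivAt (fun w : Fin N → K => w l₀) l (if l = l₀ then 1 else 0) z := by
  classical
  rw [hasPartialDerivAt_iff]
  by_cases h : l = l₀
  · subst h
    simp only [update_self, if_true]
    exact hasFieldDerivAt_id' _
  · simp only [update_of_ne (Ne.symm h), if_neg h]
    exact hasFieldDerivAt_const _ _

/-! ### The implicit function theorem for systems -/

omit [Field K] [LinearOrder K] [IsStrictOrderedRing K] [TopologicalSpace K] [OrderTopology K]
  [L.Structure K] in
/-- A point with prescribed first block: `z = append x (its last block)` when its first block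
is `x`. [folklore] -/
theorem eq_append_of_forall_castAdd {z : Fin (n + m) → K} {x : Fin n → K}
    (hz : ∀ i, z (Fin.castAdd m i) = x i) :
    z = Fin.append x (fun j => z (Fin.natAdd n j)) := by
  funext l
  induction l using Fin.addCases with
  | left i => rw [Fin.append_left, hz]
  | right j => rw [Fin.append_right]

/-- **The implicit function theorem for systems** over a definably complete ordered field:
see the module docstring. [folklore] -/
theorem _root_.FirstOrder.Language.IsDefinablyComplete.exists_implicitFunction_system
    (hDC : L.IsDefinablyComplete K)
    (hlt : (univ : Set K).Definable L {v : Fin 2 → K | v 0 < v 1})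
    (hadd : (univ : Set K).Definable L {v : Fin 3 → K | v 2 = v 0 + v 1})
    (hmul : (univ : Set K).Definable L {v : Fin 3 → K | v 2 = v 0 * v 1})
    {F : (Fin (n + m) → K) → Fin m → K} (hF : ∀ k, (univ : Set K).DefinableFun L fun z => F z k)
    {J : (Fin (n + m) → K) → Fin m → Fin (n + m) → K} {a : Fin n → K} {b : Fin m → K}
    {ρ : K} (hρ : 0 < ρ)
    (hcont : ∀ k, ContinuousOn (fun z => F z k) {z | ∀ l, |z l - Fin.append a b l| < ρ})
    (hder : ∀ z : Fin (n + m) → K, (∀ l, |z l - Fin.append a b l| < ρ) →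
      ∀ k l, HasPartialDerivAt (fun w => F w k) l (J z k l) z)
    (hJc : ∀ z : Fin (n + m) → K, (∀ l, |z l - Fin.append a b l| < ρ) →
      ∀ k l, ContinuousAt (fun w => J w k l) z)
    {Py : Fin m → Fin m → K}
    (hPyJ : ∀ k j, ∑ k', Py k k' * J (Fin.append a b) k' (Fin.natAdd n j) =
      if k = j then 1 else 0)
    (hJPy : ∀ k j, ∑ k', J (Fin.append a b) k (Fin.natAdd n k') * Py k' j =
      if k = j then 1 else 0)
    (hF0 : F (Fin.append a b) = 0) :
    ∃ r s : K, 0 < r ∧ 0 < s ∧ ∃ φ : (Fin n → K) → Fin m → K,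
      (∀ j, (univ : Set K).DefinableFun L fun x => φ x j) ∧ φ a = b ∧
      (∀ x : Fin n → K, (∀ i, |x i - a i| < r) →
        (∀ j, |φ x j - b j| < s) ∧ F (Fin.append x (φ x)) = 0) ∧
      (∀ x : Fin n → K, (∀ i, |x i - a i| < r) → ∀ y : Fin m → K, (∀ j, |y j - b j| < s) →
        F (Fin.append x y) = 0 → y = φ x) ∧
      (∀ x : Fin n → K, (∀ i, |x i - a i| < r) → ∃ g : Fin m → Fin n → K,
        (∀ j, HasLinDerivAt (fun x' => φ x' j) (g j) x) ∧
        ∀ k i, J (Fin.append x (φ x)) k (Fin.castAdd m i) +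
          ∑ j, J (Fin.append x (φ x)) k (Fin.natAdd n j) * g j i = 0) := by
  classical
  set p₀ : Fin (n + m) → K := Fin.append a b with hp₀
  -- the map `Φ (x, y) = (x, F (x, y))`, its Jacobian `JΦ` and the inverse `PΦ` of `JΦ p₀`
  set Φ : (Fin (n + m) → K) → Fin (n + m) → K :=
    fun z => Fin.append (fun i => z (Fin.castAdd m i)) (F z) with hΦ
  set JΦ : (Fin (n + m) → K) → Fin (n + m) → Fin (n + m) → K :=
    fun z => Fin.append (fun i l' => if l' = Fin.castAdd m i then (1 : K) else 0)
      (fun k l' => J z k l') with hJΦ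
  set PΦ : Fin (n + m) → Fin (n + m) → K :=
    Fin.append (fun i l' => if l' = Fin.castAdd m i then (1 : K) else 0)
      (fun k => Fin.append (fun i => -∑ j, Py k j * J p₀ j (Fin.castAdd m i)) (fun j => Py k j))
    with hPΦ
  have hΦleft : ∀ z i, Φ z (Fin.castAdd m i) = z (Fin.castAdd m i) := fun z i => by
    simp only [hΦ, Fin.append_left]
  have hΦright : ∀ z k, Φ z (Fin.natAdd n k) = F z k := fun z k => by
    simp only [hΦ, Fin.append_right]
  have hΦp₀ : Φ p₀ = Fin.append a 0 := by
    funext l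
    induction l using Fin.addCases with
    | left i => rw [hΦleft, Fin.append_left, hp₀, Fin.append_left]
    | right k => simp only [hΦright, Fin.append_right, hF0, Pi.zero_apply]
  -- the inverse of `JΦ p₀`
  have hinv := block_two_sided_inverse (n := n) (m := m) (K := K)
    (Jx := fun k i => J p₀ k (Fin.castAdd m i)) (Jy := fun k j => J p₀ k (Fin.natAdd n j))
    (Py := Py) hPyJ hJPy (M := JΦ p₀) (P := PΦ)
    (fun i l' => by simp only [hJΦ, Fin.append_left])
    (fun k i => by simp only [hJΦ, Fin.append_right])
    (fun k j => by simp only [hJΦ, Fin.append_right])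
    (fun i l' => by simp only [hPΦ, Fin.append_left])
    (fun k i => by simp only [hPΦ, Fin.append_right, Fin.append_left])
    (fun k j => by simp only [hPΦ, Fin.append_right])
  -- hypotheses of the inverse function theorem for `Φ`
  have hΦdef : ∀ l, (univ : Set K).DefinableFun L fun z => Φ z l := by
    intro l
    induction l using Fin.addCases with
    | left i => simp only [hΦleft]; exact definableFun_proj_params _
    | right k => simp only [hΦright]; exact hF k
  have hΦcont : ∀ l, ContinuousOn (fun z => Φ z l) {z | ∀ l, |z l - p₀ l| < ρ} := by
    intro l
    induction l using Fin.addCases with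
    | left i => simp only [hΦleft]; exact (continuous_apply _).continuousOn
    | right k => simp only [hΦright]; exact hcont k
  have hΦder : ∀ z : Fin (n + m) → K, (∀ l, |z l - p₀ l| < ρ) →
      ∀ l l', HasPartialDerivAt (fun w => Φ w l) l' (JΦ z l l') z := by
    intro z hz l l'
    induction l using Fin.addCases with
    | left i =>
        simp only [hΦleft, hJΦ, Fin.append_left]
        exact hasPartialDerivAt_apply _ _ _
    | right k =>
        simp only [hΦright, hJΦ, Fin.append_right]
        exact hder z hz k l'
  have hJΦc : ∀ z : Fin (n + m) → K, (∀ l, |z l - p₀ l| < ρ) →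
      ∀ l l', ContinuousAt (fun w => JΦ w l l') z := by
    intro z hz l l'
    induction l using Fin.addCases with
    | left i => simp only [hJΦ, Fin.append_left]; exact continuousAt_const
    | right k => simp only [hJΦ, Fin.append_right]; exact hJc z hz k l'
  -- the inverse function theorem
  obtain ⟨r, c, hr, -, hc, G, hGdef, hFG, hGF, -, hGd⟩ :=
    hDC.exists_localInverse_of_jacobian hlt hadd hmul hΦdef hρ hΦcont hΦder hJΦc hinv.1 hinv.2
  -- `w x = append x 0` lies in `V` when `|x - a|_∞ < c`
  have hwV : ∀ x : Fin n → K, (∀ i, |x i - a i| < c) →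
      ∀ l, |Fin.append x (0 : Fin m → K) l - Φ p₀ l| < c := by
    intro x hx l
    rw [hΦp₀]
    induction l using Fin.addCases with
    | left i => simpa only [Fin.append_left] using hx i
    | right k => simpa only [Fin.append_right, Pi.zero_apply, sub_self, abs_zero] using hc
  -- the implicit function
  set φ : (Fin n → K) → Fin m → K := fun x j => G (Fin.append x 0) (Fin.natAdd n j) with hφ
  have hGφ : ∀ x : Fin n → K, (∀ i, |x i - a i| < c) → G (Fin.append x 0) = Fin.append x (φ x) := by
    intro x hx
    have h := (hFG _ (hwV x hx)).2
    refine eq_append_of_forall_castAdd fun i => ?_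
    have hi := congr_fun h (Fin.castAdd m i)
    rw [hΦleft, Fin.append_left] at hi
    exact hi
  set r₁ : K := min r c with hr₁
  have hr₁pos : 0 < r₁ := lt_min hr hc
  refine ⟨r₁, r, hr₁pos, hr, φ, ?_, ?_, ?_, ?_, ?_⟩
  · -- definability
    intro j
    have hE : (univ : Set K).DefinableMap L
        fun (x : Fin n → K) (l : Fin (n + m)) => (Fin.append x (0 : Fin m → K) l : K) := by
      intro l
      induction l using Fin.addCases with
      | left i => simp only [Fin.append_left]; exact definableFun_proj_params _
      | right k =>
          simp only [Fin.append_right, Pi.zero_apply]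
          exact definableFun_const_params _ (mem_univ _)
    exact (hGdef (Fin.natAdd n j)).comp hE
  · -- `φ a = b`
    have haU : ∀ l, |p₀ l - p₀ l| < r := fun l => by simpa using hr
    have haV : ∀ l, |Φ p₀ l - Φ p₀ l| < c := fun l => by simpa using hc
    have h := hGF p₀ haU haV
    rw [hΦp₀] at h
    funext j
    have := congr_fun h (Fin.natAdd n j)
    simpa only [hφ, hp₀, Fin.append_right] using this
  · -- values in the `s`-ball and `F = 0`
    intro x hx
    have hxc : ∀ i, |x i - a i| < c := fun i => (hx i).trans_le (min_le_right _ _)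
    have h := hFG _ (hwV x hxc)
    rw [hGφ x hxc] at h
    refine ⟨fun j => ?_, ?_⟩
    · have := h.1 (Fin.natAdd n j)
      simpa only [Fin.append_right, hp₀] using this
    · funext k
      have := congr_fun h.2 (Fin.natAdd n k)
      simpa only [hΦright, Fin.append_right, Pi.zero_apply] using this
  · -- uniqueness
    intro x hx y hy h0
    have hxc : ∀ i, |x i - a i| < c := fun i => (hx i).trans_le (min_le_right _ _)
    have hxr : ∀ i, |x i - a i| < r := fun i => (hx i).trans_le (min_le_left _ _)
    have hU : ∀ l, |Fin.append x y l - p₀ l| < r := by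
      intro l
      induction l using Fin.addCases with
      | left i => simpa only [Fin.append_left, hp₀] using hxr i
      | right j => simpa only [Fin.append_right, hp₀] using hy j
    have hΦxy : Φ (Fin.append x y) = Fin.append x 0 := by
      funext l
      induction l using Fin.addCases with
      | left i => rw [hΦleft, Fin.append_left, Fin.append_left]
      | right k => simp only [hΦright, Fin.append_right, h0, Pi.zero_apply]
    have hV : ∀ l, |Φ (Fin.append x y) l - Φ p₀ l| < c := by
      rw [hΦxy]; exact hwV x hxc
    have h := hGF _ hU hV
    rw [hΦxy, hGφ x hxc] at h
    funext j
    have := congr_fun h (Fin.natAdd n j)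
    simpa only [Fin.append_right] using this.symm
  · -- differentiability and the implicit-differentiation identities
    intro x hx
    have hxc : ∀ i, |x i - a i| < c := fun i => (hx i).trans_le (min_le_right _ _)
    obtain ⟨⟨R, -, hJR⟩, hRd⟩ := hGd _ (hwV x hxc)
    have hd : ∀ l, HasLinDerivAt (fun w => G w l) (R l) (Fin.append x 0) := fun l => hRd R hJR l
    -- `append x 0` as a linear function of `x`
    set E : Fin (n + m) → Fin n → K :=
      fun l i => Fin.append (fun i' => if i' = i then (1 : K) else 0) (fun _ => 0) l with hE
    have hEx : ∀ x' : Fin n → K, (fun l => ∑ i, E l i * x' i) = Fin.append x' 0 := by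
      intro x'
      funext l
      induction l using Fin.addCases with
      | left i' => simp only [hE, Fin.append_left]; rw [sum_kronecker_mul']
      | right k => simp [hE, Fin.append_right]
    refine ⟨fun j i => R (Fin.natAdd n j) (Fin.castAdd m i), fun j => ?_, fun k i => ?_⟩
    · have hd' : HasLinDerivAt (fun w => G w (Fin.natAdd n j)) (R (Fin.natAdd n j))
          (fun l => ∑ i, E l i * x i) := by
        rw [hEx]; exact hd _
      have h := hd'.comp_linear E
      have hfun : (fun x' : Fin n → K => G (fun l => ∑ i, E l i * x' i) (Fin.natAdd n j)) =
          fun x' => φ x' j := by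
        funext x'
        rw [hEx x']
      have hgr : (fun i => ∑ l, R (Fin.natAdd n j) l * E l i) =
          fun i => R (Fin.natAdd n j) (Fin.castAdd m i) := by
        funext i
        rw [Fin.sum_univ_add]
        simp [hE, Fin.append_left, Fin.append_right]
      rw [hfun, hgr] at h
      exact h
    · have hz : G (Fin.append x 0) = Fin.append x (φ x) := hGφ x hxc
      have h2 : ∀ i', R (Fin.castAdd m i') (Fin.castAdd m i) = if i' = i then (1 : K) else 0 := by
        intro i'
        have h := hJR (Fin.castAdd m i') (Fin.castAdd m i)
        simp only [hJΦ, Fin.append_left] at h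
        rw [sum_kronecker_mul] at h
        rw [h]
        simp
      have h1 := hJR (Fin.natAdd n k) (Fin.castAdd m i)
      rw [if_neg (castAdd_ne_natAdd i k).symm, Fin.sum_univ_add] at h1
      simp only [hJΦ, Fin.append_right] at h1
      simp only [h2, sum_mul_kronecker, hz] at h1
      exact h1

end Literature.ModelTheory.ExponentialFields
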